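import Summits.HodgeConjecture.HodgeConjecture.Theorems.Ring2AbelianAllAndreFibreClassConstancyHolds
import Literature.AlgebraicGeometry.HodgeTheory.CrossProductTopClass
import Literature.AlgebraicGeometry.HodgeTheory.AlgebraicClassesExteriorProduct
import Literature.AlgebraicGeometry.HodgeTheory.CorrespondenceCupProductIdentities
import Literature.AlgebraicTopology.SingularHomology.CompactGroupExteriorCohomology
import HarnessLib

/-!
# Ring 2 · sub-cell AbelianAll (ALL ABELIAN VARIETIES), André axis, part XIV-a — the action of a
# CROSS-PRODUCT correspondence `∑ᵢ pr₁^* xᵢ ∪ pr₂^* yᵢ` on the real carriers: `c ↦ ∑ᵢ τ(c ∪ yᵢ) · xᵢ`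
# with ONE linear functional `τ` of the top cohomology, injective on it

HONEST FRAMING (page 1, verbatim): **research route, not a corollary; conditional on HC_CM plus one named
minimal statement.** Cell line: research route conditional on HC_CM; not a corollary; Q11.4-sentence-2
already refuted in dim ≥ 3. Nothing in this file proves a case of the Hodge conjecture. `HC_CM` =
`Theses.RankFourFaces.CMAbelianHodge` (a BINDER), item `Theses.RankFourFaces.CMToAbelian` (stmt-16267) OPEN and
not closed here. Seat `pub-hodge-ring2-ab-andre-2`, gen 6; owed item (o15) of RING2-MAP §AbelianAll AA2.39–AA2.40:
the `p = 1` rung of the fibre-class Lefschetz operator (β′_f) from PRODUCTS OF DIVISORS. This part supplies the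
one carrier input recorded there as missing — "`corrClassAction` of an exterior-product class
`pr₁^* b ∪ pr₂^* a` = `c ↦ (∫ c ∪ a) • b` (not in the tree: `corrClassAction_apply`, `_graph`, `_transposeGraph`
only)" — for arbitrary smooth projective `W`, `X` and finite sums of cross products.

## Content (theorems only; no definition, no named fact, no sorry)

* §1 `pathConnectedSpace_complexPoints`; `cupProduct_degZero_right`: on a smooth projective `W`, cup product
  with a degree-`0` class `u` is multiplication by the scalar `ε(u)`, `ε : H⁰(W(ℂ); ℂ) ≃ ℂ` the tree's
  `singularCohomologyZeroEquiv` (`H⁰ = ℂ · 1`, Hatcher §3.1 p. 199).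
* §2 `corrClassAction_cross` — **Voisin II (10.7) for a cross product**: for `x ∈ Hⁱ(W)`, `y ∈ Hᵏ(X)` and
  `c ∈ Hᵃ(X)` with `a + k = 2 dim X` (and `a·i` even),
  `(pr_W^* x ∪ pr_X^* y)^*(c) = pr_{W*}(pr_X^* c ∪ pr_W^* x ∪ pr_X^* y) = x ∪ pr_{W*} pr_X^*(c ∪ y)`
  (associativity, graded commutativity, naturality of `∪`, Hatcher 3.10–3.11, and the projection formula
  `pr_{W*}(pr_W^* x ∪ z) = x ∪ pr_{W*} z`, Fulton App. B (6), the tree's `complexGysin_cup`), for the complex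
  orientations.
* §3 `exists_crossTrace` — **the action formula with one functional**: there is a linear functional
  `τ : H^{2 dim X}(X(ℂ); ℂ) → ℂ` (namely `τ(z) = ε(pr_{W*} pr_X^* z)`) which (a) DETECTS the top class,
  `τ z = 0 ⟹ z = 0` (Künneth in the top degree of `W × X`, the tree's `complexGysin_fst_map_snd_ne_zero_of_ne_zero`),
  and (b) for every finite family of ALGEBRAIC classes `xᵢ ∈ N^β H^{2β}(W)`, `yᵢ ∈ N^α H^{2α}(X)` makes
  `T(c) := ∑ᵢ τ(c ∪ yᵢ) • xᵢ : Hᵃ(X) → H^{2β}(W)` (`a + 2α = 2 dim X`) a linear map INDUCED BY AN ALGEBRAIC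
  CORRESPONDENCE (`IsAlgebraicCorrespondence (dim W) (dim X) W X T`), namely by the codimension-`(β+α)` class
  `∑ᵢ pr_W^* xᵢ ∪ pr_X^* yᵢ ∈ N^{β+α}` (exterior products of algebraic classes are algebraic, Voisin II proof of
  Prop. 9.20, the tree's `cupProduct_map_fst_map_snd_mem_algebraicClasses`).

Part XIV-b uses §3 with `W = X = 𝒳` (the total space of a compact pencil), `xᵢ = Dᵢ` divisor classes and
`yᵢ = Aᵢ ∪ h^{d-2}`, to write down the `p = 1` quasi-inverse of `∪[𝒳_t]`; part XIV-c with `(xᵢ, yᵢ) = (1, h^d)`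
and `(h^d, 1)` for the extreme degrees.

References: VoisinHodgeII2003 ((10.7) in the proof of Thm. 10.17; §9.2.4 proof of Prop. 9.20);
VoisinHodgeI2002 (§11.3.3 Lemma 11.41); FultonYoungTableaux1997 (App. B §B.1 (3), (5), (6));
HatcherAT2002 (§3.1 p. 199, §3.2 Prop. 3.10, Thm. 3.11, Thm. 3.15); Andre1996Motifs (§2.1 p. 14).
-/

noncomputable section

set_option linter.dupNamespace false

namespace Summit.HodgeConjecture.HodgeConjecture.Ring2.AbelianAll

open CategoryTheory AlgebraicGeometry MonoidalCategory CartesianMonoidalCategory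
open Literature.AlgebraicGeometry Literature.AlgebraicGeometry.Motives
open Literature.AlgebraicGeometry.HodgeTheory
open Literature.AlgebraicTopology.SingularHomology (singularCohomology cupProduct cupProduct_one'
  cupProduct_assoc cupProduct_gradedComm_holds singularCohomologyZeroEquiv)

variable {m n : ℕ} {W X : SchemeOver ℂ}

/-! ## §1 Degree zero: `H⁰(W(ℂ); ℂ) = ℂ · 1` -/

/-- `W(ℂ)` is path connected for `W` smooth projective (connected, SGA1 XII 2.4, and locally path connected
as a topological manifold). [cite: SGA1, Exp. XII Prop. 2.4] [cite: HatcherAT2002, §3.1 p. 199] -/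
theorem pathConnectedSpace_complexPoints (hW : IsSmoothProjective m W) : PathConnectedSpace (ComplexPoints W) := by
  haveI := connectedSpace_complexPoints hW
  letI := hW.chartedSpace
  haveI : LocallyPathConnectedSpace (ComplexPoints W) :=
    ChartedSpace.locallyPathConnectedSpace (H := EuclideanSpace ℝ (Fin (2 * m))) (M := ComplexPoints W)
  exact pathConnectedSpace_iff_connectedSpace.2 inferInstance

/-- **Cup product with a degree-`0` class is a scalar**: `x ∪ u = ε(u) • x` for `u ∈ H⁰(W(ℂ); ℂ)`, where
`ε : H⁰(W(ℂ); ℂ) ≃ ℂ` is the identification of a path-connected space (`u = ε(u) • 1`, `x ∪ 1 = x`).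
[cite: HatcherAT2002, §3.1 p. 199 and §3.2 p. 211] -/
theorem cupProduct_degZero_right [PathConnectedSpace (ComplexPoints W)] {i : ℕ} (h : i + 0 = i)
    (x : complexBetti W i) (u : complexBetti W 0) :
    cupProduct h x u = singularCohomologyZeroEquiv ℂ ℂ (ComplexPoints W) u • x := by
  conv_lhs => rw [Literature.AlgebraicTopology.SingularHomology.singularCohomology.eq_smul_one ℂ u]
  rw [map_smul, cupProduct_one']

/-! ## §2 The action of one cross product `pr_W^* x ∪ pr_X^* y` -/

/-- **Voisin II (10.7) for a cross product.** For `W`, `X` smooth projective of dimensions `m`, `n`,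
`x ∈ Hⁱ(W(ℂ))`, `y ∈ Hᵏ(X(ℂ))`, `c ∈ Hᵃ(X(ℂ))` with `a + k = 2n` and `a·i` even, the correspondence action
(`corrClassAction`, for the complex orientations) of `γ = pr_W^* x ∪ pr_X^* y ∈ H^{2e}((W ⊗ X)(ℂ))` is
`γ^*(c) = pr_{W*}(pr_X^* c ∪ γ) = x ∪ pr_{W*} pr_X^*(c ∪ y)`: reassociate and commute
`pr_X^* c ∪ (pr_W^* x ∪ pr_X^* y) = pr_W^* x ∪ pr_X^*(c ∪ y)` (Hatcher 3.10, 3.11) and apply the projection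
formula for `pr_W` (Fulton App. B (6), the tree's `complexGysin_cup`).
[cite: VoisinHodgeII2003, proof of Thm. 10.17 (10.7)] [cite: FultonYoungTableaux1997, Appendix B §B.1 (3), (6)]
[cite: HatcherAT2002, §3.2 Prop. 3.10 and Thm. 3.11] -/
theorem corrClassAction_cross (hW : IsSmoothProjective m W) (hX : IsSmoothProjective n X)
    {i k e a q : ℕ} (hik : i + k = 2 * e) (hab : a + 2 * e = i + 2 * n) (hq : i + q = 2 * m)
    (hak : a + k = 2 * n) (hai : Even (a * i))
    (x : complexBetti W i) (y : complexBetti X k) (c : complexBetti X a) :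
    corrClassAction (complexOrientationFamily (hW.tensor_holds hX)) (complexOrientationFamily hW) hab hq
        (cupProduct hik (complexBetti.map (fst W X) i x) (complexBetti.map (snd W X) k y)) c =
      cupProduct (Nat.add_zero i) x
        (complexGysin complexOrientationFamily (hW.tensor_holds hX) hW (fst W X)
          (show 2 * n + 2 * m = 0 + 2 * (m + n) by omega)
          (complexBetti.map (snd W X) (2 * n) (cupProduct hak c y))) := by
  rw [corrClassAction_apply, ← complexGysin_eq_gysinMap (hW.tensor_holds hX) hW (fst W X)
    (show a + 2 * e + 2 * m = i + 2 * (m + n) by omega)]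
  -- `pr_X^* c ∪ (pr_W^* x ∪ pr_X^* y) = (pr_X^* c ∪ pr_W^* x) ∪ pr_X^* y`
  rw [← cupProduct_assoc (show a + i = a + i from rfl) hik (show a + i + k = a + 2 * e by omega) rfl]
  -- `pr_X^* c ∪ pr_W^* x = pr_W^* x ∪ pr_X^* c` (degrees `a`, `i`, `a·i` even)
  rw [cupProduct_gradedComm_holds ℂ _ (show a + i = a + i from rfl) (show i + a = a + i by omega)
    (complexBetti.map (snd W X) a c) (complexBetti.map (fst W X) i x), Even.neg_one_pow hai, one_smul]
  -- `(pr_W^* x ∪ pr_X^* c) ∪ pr_X^* y = pr_W^* x ∪ pr_X^*(c ∪ y)`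
  rw [cupProduct_assoc (show i + a = a + i by omega) hak (show a + i + k = a + 2 * e by omega)
    (show i + 2 * n = a + 2 * e by omega), ← complexBetti.map_cupProduct]
  -- projection formula for `pr_W`
  rw [complexGysin_cup hasPoincareDuality_complexOrientationFamily (hW.tensor_holds hX) hW (fst W X)
    (show i + 2 * n = a + 2 * e by omega) _ (show 2 * n + 2 * m = 0 + 2 * (m + n) by omega) (Nat.add_zero i)]

/-! ## §3 Finite sums of cross products of algebraic classes: one functional `τ` -/

/-- **The action formula with one top-degree functional.** For `W`, `X` smooth projective of dimensions `m`, `n`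
there is a linear functional `τ : H²ⁿ(X(ℂ); ℂ) → ℂ` — `τ(z) = ε(pr_{W*} pr_X^* z)` — such that
(a) `τ z = 0 ⟹ z = 0` (the fibre integral of a non-zero top class is non-zero: Künneth in the top degree,
the tree's `complexGysin_fst_map_snd_ne_zero_of_ne_zero`), and (b) for all finite families of ALGEBRAIC classes
`xᵢ ∈ N^β H^{2β}(W(ℂ))`, `yᵢ ∈ N^α H^{2α}(X(ℂ))` (`β ≤ m`) and `a + 2α = 2n`, the linear map
`T(c) = ∑ᵢ τ(c ∪ yᵢ) • xᵢ : Hᵃ(X(ℂ)) → H^{2β}(W(ℂ))` is INDUCED BY AN ALGEBRAIC CORRESPONDENCE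
(`IsAlgebraicCorrespondence m n W X T`): by the codimension-`(β+α)` algebraic class `∑ᵢ pr_W^* xᵢ ∪ pr_X^* yᵢ`
(exterior products of algebraic classes are algebraic, Voisin II proof of Prop. 9.20), §2 term by term and §1.
[cite: VoisinHodgeII2003, proof of Thm. 10.17 (10.7) and proof of Prop. 9.20]
[cite: VoisinHodgeI2002, §11.3.3 Lemma 11.41] [cite: HatcherAT2002, §3.2 Thm. 3.15 and §3.1 p. 199] -/
theorem exists_crossTrace (hW : IsSmoothProjective m W) (hX : IsSmoothProjective n X) :
    ∃ τ : complexBetti X (2 * n) →ₗ[ℂ] ℂ, (∀ z, τ z = 0 → z = 0) ∧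
      ∀ ⦃β α a : ℕ⦄ (hak : a + 2 * α = 2 * n), β ≤ m → ∀ (r : ℕ)
        (x : Fin r → complexBetti W (2 * β)) (y : Fin r → complexBetti X (2 * α)),
        (∀ i, x i ∈ algebraicClasses W β) → (∀ i, y i ∈ algebraicClasses X α) →
        ∃ T : complexBetti X a →ₗ[ℂ] complexBetti W (2 * β), IsAlgebraicCorrespondence m n W X T ∧
          ∀ c, T c = ∑ i, τ (cupProduct hak c (y i)) • x i := by
  haveI := pathConnectedSpace_complexPoints hW
  have hWX : IsSmoothProjective (m + n) (W ⊗ X) := hW.tensor_holds hX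
  let τ : complexBetti X (2 * n) →ₗ[ℂ] ℂ :=
    (singularCohomologyZeroEquiv ℂ ℂ (ComplexPoints W)).toLinearMap ∘ₗ
      (complexGysin complexOrientationFamily hWX hW (fst W X)
        (show 2 * n + 2 * m = 0 + 2 * (m + n) by omega)) ∘ₗ
        (complexBetti.map (snd W X) (2 * n)).hom
  have hτ : ∀ z, τ z = singularCohomologyZeroEquiv ℂ ℂ (ComplexPoints W)
      (complexGysin complexOrientationFamily hWX hW (fst W X) (show 2 * n + 2 * m = 0 + 2 * (m + n) by omega)
        (complexBetti.map (snd W X) (2 * n) z)) := fun _ ↦ rfl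
  refine ⟨τ, fun z hz ↦ ?_, fun β α a hak hβ r x y hx hy ↦ ?_⟩
  · by_contra hz0
    refine complexGysin_fst_map_snd_ne_zero_of_ne_zero complexOrientationFamily hW hX hz0 ?_
    rw [Literature.AlgebraicTopology.SingularHomology.singularCohomology.eq_smul_one ℂ
      (complexGysin complexOrientationFamily (hW.tensor_holds hX) hW (fst W X) _
        (complexBetti.map (snd W X) (2 * n) z)), ← hτ, hz, zero_smul]
  · set γ : complexBetti (W ⊗ X) (2 * (β + α)) := ∑ i, cupProduct (HodgeTheory.two_mul_add_two_mul β α)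
      (complexBetti.map (fst W X) (2 * β) (x i)) (complexBetti.map (snd W X) (2 * α) (y i)) with hγ
    have hγalg : γ ∈ algebraicClasses (W ⊗ X) (β + α) :=
      Submodule.sum_mem _ fun i _ ↦ cupProduct_map_fst_map_snd_mem_algebraicClasses hW hX (hx i) (hy i)
    have hab : a + 2 * (β + α) = 2 * β + 2 * n := by omega
    have hq : 2 * β + (2 * m - 2 * β) = 2 * m := by omega
    refine ⟨corrClassAction (complexOrientationFamily hWX) (complexOrientationFamily hW) hab hq γ,
      ⟨_, _, hasPoincareDuality_complexOrientationFamily hWX, hasPoincareDuality_complexOrientationFamily hW,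
        β + α, 2 * m - 2 * β, hab, hq, γ, hγalg, rfl⟩, fun c ↦ ?_⟩
    rw [hγ, map_sum, LinearMap.sum_apply]
    refine Finset.sum_congr rfl fun i _ ↦ ?_
    rw [corrClassAction_cross hW hX (HodgeTheory.two_mul_add_two_mul β α) hab hq hak ⟨a * β, by ring⟩ (x i) (y i) c,
      cupProduct_degZero_right, hτ]

end Summit.HodgeConjecture.HodgeConjecture.Ring2.AbelianAll

end
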